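import Literature.NumberTheory.LFunctions.DirichletZeroDetector
import Literature.NumberTheory.LFunctions.KhaleLemma52
import Literature.NumberTheory.LFunctions.KhaleLemma71
import HarnessLib

/-!
# Khale 2024, Lemma 6.2 (the zero detector for `L(s, χ)` with (2.4) inserted), non-principal `χ`

Topic `Literature/NumberTheory/LFunctions`.  Everything in this file is PROVED; no definition, no
named fact.  **Lemma 6.2 of T. Khale, *An explicit Vinogradov–Korobov zero-free region for
Dirichlet L-functions*, Q. J. Math. 75 (2024) = arXiv:2210.06457v1 (pp. 11–12)**, "our main
method for detecting zeros of `L(s, χ)`":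

> Assume (2.4) holds with `A, B > 0`. Let `q ≥ 3`, `χ` (mod `q`). Let `t ≥ max{e^{1938}, q^{1/100000}}`,
> `0 < η < 10`, `σ − η > 1/2`, `1 ≤ σ ≤ 1 + η − 1.92(log(t/100))^{−2/3}`, `s = σ + it`. If
> `S ⊆ {z : σ − η ≤ Re z ≤ 1}` then
> `−Re L'/L(s, χ) ≤ −Σ_{ρ ∈ S, L(ρ,χ)=0} Re (π/2η) cot(π(s − ρ)/2η)`
> `  + (1/2η)((1 − σ + η) log q + ⅔ log log t + B(1 − σ + η)^{3/2} log t + log(A + 1))`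
> `  − (1/4η) ∫ log|L(s + η + 2ηiu/π, χ)|/cosh²u du + (1 − a)(1 − δ(χ)) e^{−1937}.`

For a NON-PRINCIPAL character we prove it — without the last term, which is `≥ 0` — from the
tree's whole-line detector for `L(s, χ)` (`DirichletDetector.ford_zero_detector_LFunction`,
Khale's Lemma 6.1 with `T → ∞` done, `DirichletZeroDetector.lean`) and Lemma 5.2 on the left line
`Re z = σ − η` (`KhaleL52.lemma52`, `a = 2η/π`), under the restrictions `η < 3/4` (so that
`a = 2η/π ≤ 1/2`, as Lemma 5.2 requires; the source's `η < 10` silently exceeds this) and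
`σ + η ≤ 5/2` (the right line stays in the half-strip `Re z ≤ 3` of the tree's detector); every use
of Lemma 6.2 in the source has `η ≤ 2.5 · ¼` and `σ ≤ 1 + η` (Lemma 6.3, Corollary 6.6, (8.2),
Appendix B), well inside.  (The source applies Lemma 6.1 to `f = s^{(1−δ(χ))(a−1)} L(s, χ)` to
meet the hypothesis `f(0) ≠ 0` of Ford's Lemma 2.2, and the term `(1 − a)(1 − δ(χ))e^{−1937}`
pays for the factor `s^{−1}`; the rectangle-contour detector of the tree needs no such factor.)

* `KhaleL62.lemma62_of_good` — the inequality when no zero of `L(·, χ)` lies on `Re z = σ − η`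
  (Ford's "good `η`"), for `S` any finite set of zeros with `Re ρ > σ − η`;
* `KhaleL62.lemma62` — **Lemma 6.2 for every `η`** (`0 < η < 3/4`, `σ − η > 1/2`,
  `σ + η ≤ 5/2`), `S` any finite set of zeros with `Re ρ ≥ σ − η`: the good case at good
  `η_n ↓ η` (the bad `η` are countably many, `exists_good_eta`) and `n → ∞` — the left side does
  not depend on `η`; the zero sum, the explicit term and (by dominated convergence, with
  `|log|L(x + iy, χ)|| ≤ (3/2) Σ_p p^{−1−η}` on `x ≥ 1 + η`) the right-line integral are
  continuous in `η`.

## References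

* T. Khale, arXiv:2210.06457v1, Lemma 6.2 and its proof (pp. 11–12). [Khale2024]
* K. Ford, *Zero-free regions for the Riemann zeta function* (2002), Lemma 4.1 and the last
  sentence of its proof ("if `η` is bad … apply the above argument with a sequence of numbers
  `η'` tending to `η`"). [Ford2002Millennium]
-/

noncomputable section

open Complex Set Metric Filter Topology MeasureTheory Real
open Literature.Analysis.Complex Literature.Analysis.Complex.FordDetector

namespace Literature.NumberTheory.LFunctions

namespace KhaleL62

open DirichletDisc DirichletDetector

variable {q : ℕ} [NeZero q] {χ : DirichletCharacter ℂ q}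

/-! ### Lemma 6.2 for a good `η` -/

/-- **Khale 2024, Lemma 6.2 (non-principal `χ`), for `η` with no zero of `L(·, χ)` on
`Re z = σ − η`.** Assume (2.4) (`HasHurwitzFordBound A B`, `A, B > 0`), `q ≥ 3`, `χ ≠ χ₀` mod `q`,
`t ≥ e^{1938}`, `t ≥ q^{1/100000}`, `0 < η ≤ 3/4`, `1/2 ≤ σ − η`, `1 ≤ σ ≤ 1 + η − 1.92(log(t/100))^{−2/3}`,
`σ + η ≤ 3`, and let `S` be a finite set of zeros with `Re ρ > σ − η`. Then
`−Re L'/L(s, χ) ≤ Σ_{ρ∈S} m(ρ) Re h_η(ρ − s) + (1/2η)((1−σ+η) log q + ⅔ log log t + B(1−σ+η)^{3/2} log t + log(A+1))`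
`  − (1/4η) ∫ log|L(σ + η + i(t + 2ηu/π), χ)|/cosh²u du`
(`h_η(z) = (π/2η)cot(πz/2η)`, odd, so `Re h_η(ρ − s) = −Re (π/2η)cot(π(s − ρ)/2η)`).
[cite: Khale2024, Lemma 6.2] -/
theorem lemma62_of_good {A B : ℝ} (hA : 0 < A) (hB : 0 < B) (hF : HasHurwitzFordBound A B)
    (hq : 3 ≤ q) (hχ : χ ≠ 1) {σ t η : ℝ} (ht : Real.exp 1938 ≤ t)
    (htq : (q : ℝ) ^ (1 / 100000 : ℝ) ≤ t) (hη : 0 < η) (hη34 : η ≤ 3 / 4)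
    (hleft : 1 / 2 ≤ σ - η) (hσ : 1 ≤ σ)
    (hσ' : σ ≤ 1 + η - 1.92 * Real.log (t / 100) ^ (-(2 / 3 : ℝ))) (hright : σ + η ≤ 3)
    (hgood : ∀ ρ : ℂ, χ.LFunction ρ = 0 → ρ.re ≠ σ - η)
    (S : Finset ℂ) (hS : ∀ ρ ∈ S, χ.LFunction ρ = 0 ∧ σ - η < ρ.re) :
    -(deriv χ.LFunction (σ + t * I) / χ.LFunction (σ + t * I)).re ≤
      (∑ ρ ∈ S, (zeroOrder χ ρ : ℝ) * (fordCot η (ρ - (σ + t * I))).re)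
      + 1 / (2 * η) * ((1 - σ + η) * Real.log q + 2 / 3 * Real.log (Real.log t)
          + B * (1 - σ + η) ^ (3 / 2 : ℝ) * Real.log t + Real.log (A + 1))
      - 1 / (4 * η) * ∫ u : ℝ, Real.log ‖χ.LFunction ((σ + η : ℝ) + ((t + u * (2 * η / π) : ℝ) : ℂ) * I)‖
          / Real.cosh u ^ 2 := by
  have h := ford_zero_detector_LFunction hχ (t := t) hη hσ hleft hright hgood S hS
  -- Lemma 5.2 on the left line `Re z = σ - η`, `a = 2η/π`
  have ha : 0 < 2 * η / π := by positivity
  have ha2 : 2 * η / π ≤ 1 / 2 := by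
    rw [div_le_iff₀ Real.pi_pos]
    have := Real.pi_gt_three
    nlinarith
  have hpow : 0 < 1.92 * Real.log (t / 100) ^ (-(2 / 3 : ℝ)) := by
    have ht6 : (10 : ℝ) ^ 6 ≤ t := KhaleL52.exp_1938_ge.trans ht
    have : 0 < Real.log (t / 100) := Real.log_pos (by
      rw [lt_div_iff₀ (by norm_num)]; nlinarith)
    positivity
  have hσ1 : σ - η < 1 := by linarith
  have h51a : 1.92 * Real.log (t / 100) ^ (-(2 / 3 : ℝ)) ≤ 1 - (σ - η) := by linarith
  have hL := KhaleL52.lemma52 hA hB hF hq χ hχ (σ := σ - η) (a := 2 * η / π) (t := t)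
    hleft hσ1 ha ha2 h51a htq ht
  rw [show 1 - (σ - η) = 1 - σ + η by ring] at hL
  have hη4 : 0 < 1 / (4 * η) := by positivity
  have key := mul_le_mul_of_nonneg_left hL hη4.le
  have e : 1 / (4 * η) * (2 * (Real.log (A + 1) + (1 - σ + η) * Real.log q
      + B * (1 - σ + η) ^ (3 / 2 : ℝ) * Real.log t + 2 / 3 * Real.log (Real.log t)))
      = 1 / (2 * η) * ((1 - σ + η) * Real.log q + 2 / 3 * Real.log (Real.log t)
          + B * (1 - σ + η) ^ (3 / 2 : ℝ) * Real.log t + Real.log (A + 1)) := by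
    field_simp; ring
  rw [e] at key
  rw [mul_sub] at h
  linarith

/-! ### Good `η` are dense: the zeros are countable -/

/-- The zeros of `L(·, χ)` (`χ ≠ χ₀`) form a countable set. [folklore] -/
theorem countable_zeros_LFunction (hχ : χ ≠ 1) : {ρ : ℂ | χ.LFunction ρ = 0}.Countable := by
  have h : {ρ : ℂ | χ.LFunction ρ = 0} ⊆ ⋃ n : ℕ, {ρ : ℂ | ρ ∈ closedBall (0 : ℂ) n ∧ χ.LFunction ρ = 0} := by
    intro ρ hρ
    refine mem_iUnion.2 ⟨⌈‖ρ‖⌉₊, ?_, hρ⟩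
    rw [mem_closedBall, dist_zero_right]
    exact Nat.le_ceil _
  exact (countable_iUnion fun n : ℕ ↦ (finite_zeros_closedBall hχ 0 (n : ℝ)).countable).mono h

/-- Off the countably many bad values `σ − Re ρ`, arbitrarily close to `η⁺`: for `ε > 0` there
is `η' ∈ (η, η + ε)` with no zero of `L(·, χ)` on `Re z = σ − η'`. [folklore] -/
theorem exists_good_eta (hχ : χ ≠ 1) (σ η : ℝ) {ε : ℝ} (hε : 0 < ε) :
    ∃ η' : ℝ, η < η' ∧ η' < η + ε ∧ ∀ ρ : ℂ, χ.LFunction ρ = 0 → ρ.re ≠ σ - η' := by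
  set Bad : Set ℝ := (fun ρ : ℂ ↦ σ - ρ.re) '' {ρ : ℂ | χ.LFunction ρ = 0} with hBad
  have hcount : Bad.Countable := (countable_zeros_LFunction hχ).image _
  have hT : ¬ (Ioo η (η + ε) ⊆ Bad) := by
    intro hsub
    have h0 : volume (Ioo η (η + ε)) = 0 := measure_mono_null hsub (hcount.measure_zero volume)
    rw [Real.volume_Ioo] at h0
    have : ENNReal.ofReal (η + ε - η) ≠ 0 := by
      rw [ENNReal.ofReal_ne_zero_iff]; linarith
    exact this h0
  obtain ⟨η', hη'T, hη'B⟩ := not_subset.1 hT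
  refine ⟨η', hη'T.1, hη'T.2, fun ρ hρ hre ↦ hη'B ⟨ρ, hρ, ?_⟩⟩
  simp only
  rw [hre]; ring

/-! ### Continuity in `η` of the right-hand side -/

/-- Continuity of `η ↦ Re h_η(w)` at `η > 0` when `w ≠ 0`, `|Re w| < 2η`
(`sin(πw/2η) ≠ 0`). [folklore] -/
theorem continuousAt_re_fordCot {η₀ : ℝ} (hη₀ : 0 < η₀) {w : ℂ} (hw : w ≠ 0) (hre : |w.re| < 2 * η₀) :
    ContinuousAt (fun η : ℝ ↦ (fordCot η w).re) η₀ := by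
  have hsin := sin_ne_zero_of_abs_re_lt hη₀ hw hre
  have hc : ContinuousAt (fun η : ℝ ↦ (((π / (2 * η) : ℝ) : ℂ))) η₀ := by
    refine (Complex.continuous_ofReal.continuousAt).comp ?_
    exact ContinuousAt.div continuousAt_const (continuousAt_const.mul continuousAt_id) (by positivity)
  have hcw : ContinuousAt (fun η : ℝ ↦ ((π / (2 * η) : ℝ) : ℂ) * w) η₀ := hc.mul continuousAt_const
  have hcot : ContinuousAt (fun η : ℝ ↦ Complex.cot (((π / (2 * η) : ℝ) : ℂ) * w)) η₀ := by
    have h1 : ContinuousAt (fun η : ℝ ↦ Complex.cos (((π / (2 * η) : ℝ) : ℂ) * w) /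
        Complex.sin (((π / (2 * η) : ℝ) : ℂ) * w)) η₀ :=
      (Complex.continuous_cos.continuousAt.comp hcw).div
        (Complex.continuous_sin.continuousAt.comp hcw) hsin
    refine h1.congr (Eventually.of_forall fun η ↦ ?_)
    simp [Complex.cot_eq_cos_div_sin]
  have h := hc.mul hcot
  exact Complex.continuous_re.continuousAt.comp (f := fun η : ℝ ↦ fordCot η w) h

/-- For `Re s ≥ x₀ > 1`: `|log|L(s, ψ)|| ≤ (3/2) Σ_p p^{−x₀}`. [folklore] -/
theorem abs_log_norm_LFunction_le_of_le (ψ : DirichletCharacter ℂ q) {x₀ : ℝ} (hx₀ : 1 < x₀) {z : ℂ}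
    (hz : x₀ ≤ z.re) :
    |Real.log ‖ψ.LFunction z‖| ≤ 3 / 2 * ∑' p : Nat.Primes, (p : ℝ) ^ (-x₀) := by
  have h := KhaleL71.abs_log_norm_LFunction_le ψ (s := z) (by linarith)
  refine h.trans (mul_le_mul_of_nonneg_left ?_ (by norm_num))
  refine Summable.tsum_le_tsum (fun p ↦ ?_) (FordTrig.summable_prime_rpow_neg (by linarith))
    (FordTrig.summable_prime_rpow_neg hx₀)
  have hp : (1 : ℝ) ≤ p := by exact_mod_cast p.2.one_lt.le
  exact Real.rpow_le_rpow_of_exponent_le hp (by linarith)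

/-- **Continuity in `η` of the right-line integral**: along any sequence `η_n → η₀ > 0` with
`η_n ≥ η₀`, `∫ log|L(σ + η_n + i(t + 2η_n u/π), χ)|/cosh²u du → ∫ log|L(σ + η₀ + i(t + 2η₀u/π), χ)|/cosh²u du`
(`σ ≥ 1`, `χ ≠ χ₀`; dominated convergence with `(3/2)Σ_p p^{−1−η₀}`). [folklore] -/
theorem tendsto_integral_right (hχ : χ ≠ 1) {σ t η₀ : ℝ} (hσ : 1 ≤ σ) (hη₀ : 0 < η₀) {ηs : ℕ → ℝ}
    (hηge : ∀ n, η₀ ≤ ηs n) (hη : Tendsto ηs atTop (𝓝 η₀)) :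
    Tendsto (fun n ↦ ∫ u : ℝ, Real.log ‖χ.LFunction ((σ + ηs n : ℝ) +
        ((t + u * (2 * ηs n / π) : ℝ) : ℂ) * I)‖ / Real.cosh u ^ 2) atTop
      (𝓝 (∫ u : ℝ, Real.log ‖χ.LFunction ((σ + η₀ : ℝ) +
        ((t + u * (2 * η₀ / π) : ℝ) : ℂ) * I)‖ / Real.cosh u ^ 2)) := by
  set M : ℝ := 3 / 2 * ∑' p : Nat.Primes, (p : ℝ) ^ (-(1 + η₀)) with hM
  have hdiff := DirichletCharacter.differentiable_LFunction hχ
  -- joint continuity of the integrand in `η`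
  have hpt : ∀ (u : ℝ) {η : ℝ}, 0 < η →
      ContinuousAt (fun η : ℝ ↦ Real.log ‖χ.LFunction ((σ + η : ℝ) +
        ((t + u * (2 * η / π) : ℝ) : ℂ) * I)‖) η := by
    intro u η hη
    have hne : χ.LFunction (((σ + η : ℝ) : ℂ) + ((t + u * (2 * η / π) : ℝ) : ℂ) * I) ≠ 0 :=
      DirichletCharacter.LFunction_ne_zero_of_one_le_re χ (Or.inl hχ) (by simp; linarith)
    have h1 : ContinuousAt (fun η : ℝ ↦ χ.LFunction (((σ + η : ℝ) : ℂ) +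
        ((t + u * (2 * η / π) : ℝ) : ℂ) * I)) η :=
      hdiff.continuous.continuousAt.comp
        (f := fun η : ℝ ↦ ((σ + η : ℝ) : ℂ) + ((t + u * (2 * η / π) : ℝ) : ℂ) * I) (by fun_prop)
    exact (h1.norm).log (norm_ne_zero_iff.2 hne)
  refine tendsto_integral_filter_of_dominated_convergence (fun u ↦ M * (1 / Real.cosh u ^ 2)) ?_ ?_ ?_ ?_
  · refine Eventually.of_forall fun n ↦ ?_
    refine (Continuous.div ?_ (by fun_prop) fun u ↦ (pow_pos (Real.cosh_pos u) 2).ne').aestronglyMeasurable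
    refine continuous_iff_continuousAt.2 fun u ↦ ?_
    have hn := hηge n
    have hne : χ.LFunction (((σ + ηs n : ℝ) : ℂ) + ((t + u * (2 * ηs n / π) : ℝ) : ℂ) * I) ≠ 0 :=
      DirichletCharacter.LFunction_ne_zero_of_one_le_re χ (Or.inl hχ) (by simp; linarith)
    have h1 : ContinuousAt (fun u : ℝ ↦ χ.LFunction (((σ + ηs n : ℝ) : ℂ) +
        ((t + u * (2 * ηs n / π) : ℝ) : ℂ) * I)) u :=
      hdiff.continuous.continuousAt.comp
        (f := fun u : ℝ ↦ ((σ + ηs n : ℝ) : ℂ) + ((t + u * (2 * ηs n / π) : ℝ) : ℂ) * I) (by fun_prop)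
    exact (h1.norm).log (norm_ne_zero_iff.2 hne)
  · refine Eventually.of_forall fun n ↦ ae_of_all _ fun u ↦ ?_
    rw [Real.norm_eq_abs, abs_div, abs_of_pos (pow_pos (Real.cosh_pos u) 2), div_eq_mul_one_div]
    refine mul_le_mul_of_nonneg_right ?_ (by positivity)
    exact abs_log_norm_LFunction_le_of_le χ (by linarith) (by simp; linarith [hηge n])
  · exact (Literature.Analysis.SpecialFunctions.integrable_inv_cosh_sq).const_mul M
  · refine ae_of_all _ fun u ↦ ?_
    have h := (hpt u hη₀).tendsto.comp hη
    simpa [Function.comp_def] using h.div_const (Real.cosh u ^ 2)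

/-! ### Lemma 6.2 for every `η` -/

/-- **Khale 2024, Lemma 6.2 (non-principal `χ`).** Assume (2.4) (`HasHurwitzFordBound A B`,
`A, B > 0`), `q ≥ 3`, `χ ≠ χ₀` mod `q`, `t ≥ e^{1938}`, `t ≥ q^{1/100000}`, `0 < η < 3/4`,
`σ − η > 1/2`, `1 ≤ σ ≤ 1 + η − 1.92(log(t/100))^{−2/3}`, `σ + η ≤ 5/2`, and let `S` be a finite set
of zeros of `L(·, χ)` with `Re ρ ≥ σ − η` (i.e. `S ⊆ {σ − η ≤ Re z ≤ 1}`). Then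
`−Re L'/L(s, χ) ≤ Σ_{ρ∈S} m(ρ) Re h_η(ρ − s) + (1/2η)((1−σ+η) log q + ⅔ log log t + B(1−σ+η)^{3/2} log t + log(A+1))`
`  − (1/4η) ∫ log|L(σ + η + i(t + 2ηu/π), χ)|/cosh²u du`,
the printed inequality without its (non-negative) last term `(1 − a)(1 − δ(χ))e^{−1937}`.
[cite: Khale2024, Lemma 6.2] -/
theorem lemma62 {A B : ℝ} (hA : 0 < A) (hB : 0 < B) (hF : HasHurwitzFordBound A B)
    (hq : 3 ≤ q) (hχ : χ ≠ 1) {σ t η : ℝ} (ht : Real.exp 1938 ≤ t)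
    (htq : (q : ℝ) ^ (1 / 100000 : ℝ) ≤ t) (hη : 0 < η) (hη34 : η < 3 / 4)
    (hleft : 1 / 2 < σ - η) (hσ : 1 ≤ σ)
    (hσ' : σ ≤ 1 + η - 1.92 * Real.log (t / 100) ^ (-(2 / 3 : ℝ))) (hright : σ + η ≤ 5 / 2)
    (S : Finset ℂ) (hS : ∀ ρ ∈ S, χ.LFunction ρ = 0 ∧ σ - η ≤ ρ.re) :
    -(deriv χ.LFunction (σ + t * I) / χ.LFunction (σ + t * I)).re ≤
      (∑ ρ ∈ S, (zeroOrder χ ρ : ℝ) * (fordCot η (ρ - (σ + t * I))).re)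
      + 1 / (2 * η) * ((1 - σ + η) * Real.log q + 2 / 3 * Real.log (Real.log t)
          + B * (1 - σ + η) ^ (3 / 2 : ℝ) * Real.log t + Real.log (A + 1))
      - 1 / (4 * η) * ∫ u : ℝ, Real.log ‖χ.LFunction ((σ + η : ℝ) + ((t + u * (2 * η / π) : ℝ) : ℂ) * I)‖
          / Real.cosh u ^ 2 := by
  -- good `η_n ∈ (η, η + δ/(n+2))`
  set δ : ℝ := min (min (σ - η - 1 / 2) (3 / 4 - η)) (1 / 2) with hδ
  have hδ0 : 0 < δ := lt_min (lt_min (by linarith) (by linarith)) (by norm_num)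
  have hδ1 : δ ≤ σ - η - 1 / 2 := (min_le_left _ _).trans (min_le_left _ _)
  have hδ2 : δ ≤ 3 / 4 - η := (min_le_left _ _).trans (min_le_right _ _)
  have hδ3 : δ ≤ 1 / 2 := min_le_right _ _
  have hch : ∀ n : ℕ, ∃ η' : ℝ, η < η' ∧ η' < η + δ / (n + 2) ∧
      ∀ ρ : ℂ, χ.LFunction ρ = 0 → ρ.re ≠ σ - η' := fun n ↦
    exists_good_eta hχ σ η (by positivity)
  choose ηs hη1 hη2 hgood using hch
  have hηle : ∀ n, ηs n ≤ η + δ / 2 := fun n ↦ by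
    have h1 := hη2 n
    have h2 : δ / (n + 2) ≤ δ / 2 := div_le_div_of_nonneg_left hδ0.le (by norm_num) (by
      have := (Nat.cast_nonneg n : (0 : ℝ) ≤ n); linarith)
    linarith
  have hη_tend : Tendsto ηs atTop (𝓝 η) := by
    have h0 : Tendsto (fun n : ℕ ↦ η + δ / ((n : ℝ) + 2)) atTop (𝓝 (η + 0)) :=
      tendsto_const_nhds.add ((tendsto_const_nhds (x := δ)).div_atTop
        (tendsto_atTop_add_const_right atTop (2 : ℝ) tendsto_natCast_atTop_atTop))
    rw [add_zero] at h0
    exact tendsto_of_tendsto_of_tendsto_of_le_of_le tendsto_const_nhds h0 (fun n ↦ (hη1 n).le)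
      (fun n ↦ (hη2 n).le)
  -- the inequality at `η_n`
  have hineq : ∀ n,
      -(deriv χ.LFunction (σ + t * I) / χ.LFunction (σ + t * I)).re ≤
        (∑ ρ ∈ S, (zeroOrder χ ρ : ℝ) * (fordCot (ηs n) (ρ - (σ + t * I))).re)
        + 1 / (2 * ηs n) * ((1 - σ + ηs n) * Real.log q + 2 / 3 * Real.log (Real.log t)
            + B * (1 - σ + ηs n) ^ (3 / 2 : ℝ) * Real.log t + Real.log (A + 1))
        - 1 / (4 * ηs n) * ∫ u : ℝ, Real.log ‖χ.LFunction ((σ + ηs n : ℝ) +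
            ((t + u * (2 * ηs n / π) : ℝ) : ℂ) * I)‖ / Real.cosh u ^ 2 := by
    intro n
    have h1 := hη1 n
    have h2 := hηle n
    exact lemma62_of_good hA hB hF hq hχ ht htq (by linarith) (by linarith) (by linarith) hσ
      (by linarith) (by linarith) (hgood n) S (fun ρ hρ ↦ ⟨(hS ρ hρ).1, by linarith [(hS ρ hρ).2]⟩)
  -- limits of the right-hand side
  have hZS : Tendsto (fun n ↦ ∑ ρ ∈ S, (zeroOrder χ ρ : ℝ) * (fordCot (ηs n) (ρ - (σ + t * I))).re)
      atTop (𝓝 (∑ ρ ∈ S, (zeroOrder χ ρ : ℝ) * (fordCot η (ρ - (σ + t * I))).re)) := by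
    refine tendsto_finsetSum _ fun ρ hρ ↦ ?_
    obtain ⟨h0, hre⟩ := hS ρ hρ
    have hlt : ρ.re < 1 := re_lt_one_of_LFunction_eq_zero hχ h0
    have hw : ρ - (σ + t * I) ≠ 0 := by
      intro h
      have := congrArg Complex.re h
      simp at this
      linarith
    have hwre : |(ρ - (σ + t * I)).re| < 2 * η := by
      have e : (ρ - (σ + t * I)).re = ρ.re - σ := by simp
      rw [e, abs_lt]; constructor <;> linarith
    exact ((continuousAt_re_fordCot hη hw hwre).tendsto.comp hη_tend).const_mul _
  have hE : Tendsto (fun n ↦ 1 / (2 * ηs n) * ((1 - σ + ηs n) * Real.log q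
        + 2 / 3 * Real.log (Real.log t) + B * (1 - σ + ηs n) ^ (3 / 2 : ℝ) * Real.log t
        + Real.log (A + 1))) atTop
      (𝓝 (1 / (2 * η) * ((1 - σ + η) * Real.log q + 2 / 3 * Real.log (Real.log t)
        + B * (1 - σ + η) ^ (3 / 2 : ℝ) * Real.log t + Real.log (A + 1)))) := by
    have hr : Continuous fun x : ℝ ↦ (1 - σ + x) ^ (3 / 2 : ℝ) :=
      (Real.continuous_rpow_const (by norm_num)).comp (by fun_prop)
    have h1 : Continuous fun x : ℝ ↦ (1 - σ + x) * Real.log q + 2 / 3 * Real.log (Real.log t)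
        + B * (1 - σ + x) ^ (3 / 2 : ℝ) * Real.log t + Real.log (A + 1) :=
      ((((continuous_const.sub continuous_const).add continuous_id).mul continuous_const).add
        continuous_const).add ((continuous_const.mul hr).mul continuous_const) |>.add continuous_const
    have h2 : ContinuousAt (fun x : ℝ ↦ 1 / (2 * x)) η :=
      ContinuousAt.div continuousAt_const (by fun_prop) (by positivity)
    have h3 : ContinuousAt (fun x : ℝ ↦ 1 / (2 * x) * ((1 - σ + x) * Real.log q
        + 2 / 3 * Real.log (Real.log t) + B * (1 - σ + x) ^ (3 / 2 : ℝ) * Real.log t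
        + Real.log (A + 1))) η := h2.mul h1.continuousAt
    exact h3.tendsto.comp hη_tend
  have hI := tendsto_integral_right hχ (t := t) hσ hη (fun n ↦ (hη1 n).le) hη_tend
  have hinv : Tendsto (fun n ↦ 1 / (4 * ηs n)) atTop (𝓝 (1 / (4 * η))) := by
    have h2 : ContinuousAt (fun x : ℝ ↦ 1 / (4 * x)) η :=
      ContinuousAt.div continuousAt_const (by fun_prop) (by positivity)
    exact h2.tendsto.comp hη_tend
  have hR : Tendsto (fun n ↦
      (∑ ρ ∈ S, (zeroOrder χ ρ : ℝ) * (fordCot (ηs n) (ρ - (σ + t * I))).re)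
        + 1 / (2 * ηs n) * ((1 - σ + ηs n) * Real.log q + 2 / 3 * Real.log (Real.log t)
            + B * (1 - σ + ηs n) ^ (3 / 2 : ℝ) * Real.log t + Real.log (A + 1))
        - 1 / (4 * ηs n) * ∫ u : ℝ, Real.log ‖χ.LFunction ((σ + ηs n : ℝ) +
            ((t + u * (2 * ηs n / π) : ℝ) : ℂ) * I)‖ / Real.cosh u ^ 2) atTop
      (𝓝 ((∑ ρ ∈ S, (zeroOrder χ ρ : ℝ) * (fordCot η (ρ - (σ + t * I))).re)
        + 1 / (2 * η) * ((1 - σ + η) * Real.log q + 2 / 3 * Real.log (Real.log t)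
            + B * (1 - σ + η) ^ (3 / 2 : ℝ) * Real.log t + Real.log (A + 1))
        - 1 / (4 * η) * ∫ u : ℝ, Real.log ‖χ.LFunction ((σ + η : ℝ) +
            ((t + u * (2 * η / π) : ℝ) : ℂ) * I)‖ / Real.cosh u ^ 2)) :=
    (hZS.add hE).sub (hinv.mul hI)
  exact ge_of_tendsto' hR hineq

end KhaleL62

end Literature.NumberTheory.LFunctions
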